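import Summits.Langlands.Langlands.Theorems.ReciprocityUpToIrreducibility.Negative.FontaineSpecUnramifiedTwist
import Summits.Langlands.Langlands.Theorems.ReciprocityUpToIrreducibility.Negative.TrivialCharacterLocalGlobal
import Summits.Langlands.Langlands.Theorems.IrreducibilityBySelfDualityReciprocityUpToIrreducibility
import Summits.Langlands.Langlands.Theorems.IrreducibilityBySelfDualityIrreducibleOffSectorTransfer
import Literature.FieldTheory.AlgClosed.PadicAlgClEquivComplex
import HarnessLib

/-!
# `ReciprocityUpToIrreducibility` (stmt-Langlands-14328) — negative knowledge III:
# the crux DECIDES a property of the ε-pinned Fontaine datum (which its specification now pins too)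

Sorry-free, pure theorems, axioms `propext`/`Classical.choice`/`Quot.sound` (cdisprove cycle 1, seat
refuter-cdisprove-stmt-Langlands-14328-0; re-scoped 2026-08-17, see the repair note).  Nothing here
refutes the item (it is consistent: true in the intended model if reciprocity holds); it records,
kernel-checked, what the crux decides about the pinned datum.  Write `WDT(𝔇)` (prose only) for
`𝔇.IsWeilDeligneOf 1 (WeilDeligneRep.trivial _ _)`.

* `reciprocityUpToIrreducibility_isWeilDeligneOf_one_trivial` — the crux proves
  `WDT(fontainePstAdicCompletion v ℓ hv)` at every `v ∣ ℓ` of every number field: direction (A') at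
  `n = 1` for `π_𝟙` (`exists_trivial_cuspidal`) yields `ρ` with Satake `{1}` a.e., hence `ρ = 1`
  (`eq_one_of_satakeFrobCompatible_trivial`), and local–global compatibility at `v` pins the datum
  (`isWeilDeligneOf_trivial_of_localGlobalCompatibleAt`).  Likewise the summit
  (`langlands_isWeilDeligneOf_one_trivial`, through p78886) and the `stub_pairCompatibility` STATEMENT
  of line `Sketch` (`pairCompatibility_isWeilDeligneOf_one_trivial`, with `ρ = 1` directly: rank one is
  irreducible, `1` is unramified hence de Rham for every datum, Satake `{1}` a.e.).
* `exists_not_isWeilDeligneOf_one_trivial_adicCompletion` — the bare type at the summit's places has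
  inhabitants failing `WDT` (the `else` branch of `Classical.epsilon`).
* `isWeilDeligneOf_one_trivial_fontainePstAdicCompletion`,
  `forall_isFontaineDatum_isWeilDeligneOf_one_trivial` — since the 2026-08-16 re-type of
  `IsFontaineDatum` (clause (F8)), `WDT` holds for EVERY datum with Fontaine's clauses, in particular
  for the pinned one under `FontaineDatumExists` alone (negative knowledge I,
  `isWeilDeligneOf_one_trivial_of_isFontaineDatum`).

**Repair / re-scoping 2026-08-17 (fullbuild breakage, cascade from negative knowledge I).** The first
version's headline was the SEPARATION `reciprocityUpToIrreducibility_separates_fontaineSpec` /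
`not_forall_isFontaineDatum_isWeilDeligneOf_one_trivial`: under the crux and `FontaineDatumExists`
some datum with ALL clauses (F1)–(F7) of the 2026-08-16 specification fails `WDT` while the pinned
`fontainePstAdicCompletion v ℓ hv = Classical.epsilon (IsFontaineDatum _)` satisfies it — read META
as "the `v ∣ ℓ` local–global clause of the crux is undecidable in the tree until `WD ∘ D_pst` is
CONSTRUCTED or `IsFontaineDatum` gains a Frobenius-normalisation clause", with repair candidate (i)
"clause (F8): `IsWeilDeligneOf ρ r` with `ρ` unramified ⇒ `r ≅ (ρ|_{W_F}, 0)`". Candidate (i) WAS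
ADOPTED (statement re-type of `Literature/NumberTheory/PAdicHodge/FontaineDpst.lean`, 2026-08-16T17:19Z,
clause `isEquivalent_weilRestrict_of_isLocallyUnramified`): the specification now pins `WDT`, both
separation statements are FALSE, and — Theorems files being append-only — their names are kept only
as `@[deprecated]` aliases of the positive statements that replace them
(`isWeilDeligneOf_one_trivial_fontainePstAdicCompletion`,
`forall_isFontaineDatum_isWeilDeligneOf_one_trivial`). What the crux still adds over the
specification at `v ∣ ℓ` is no longer visible on the pair (`π_𝟙`, `ρ = 1`).
[folklore]
-/

noncomputable section

set_option linter.dupNamespace false -- project-wide option; `Summit.Langlands.Langlands` is the mandated namespace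

open scoped MatrixGroups NumberField Classical
open Field Filter IsDedekindDomain
open Literature.NumberTheory.Automorphic Literature.NumberTheory.GaloisRepresentations
open Literature.NumberTheory.PAdicHodge
open Summit.Langlands
open Summit.Langlands.Langlands.Theses.IrreducibilityBySelfDuality (ReciprocityUpToIrreducibility)
open Summit.Langlands.Langlands.Theorems.ReciprocityUpToIrreducibility
  (langlands_iff_reciprocityUpToIrreducibility_and_irreducible)

namespace Summit.Langlands.Langlands.Theorems.ReciprocityUpToIrreducibility.Negative

variable {K : Type} [Field K] [NumberField K] {ℓ : ℕ} [Fact ℓ.Prime]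

/-- **§B, crux form.** `ReciprocityUpToIrreducibility` DECIDES the Weil–Deligne normalisation of
the ε-pinned datum: at every place `v ∣ ℓ` of every number field the datum
`fontainePstAdicCompletion v ℓ hv` attaches the trivial Weil–Deligne representation to the trivial
rank-one representation. (For the 2026-08-16 specification (F1)–(F7) this was NOT a consequence of
`IsFontaineDatum`; since clause (F8) it is — `isWeilDeligneOf_one_trivial_fontainePstAdicCompletion`,
repair note.) [folklore] -/
theorem reciprocityUpToIrreducibility_isWeilDeligneOf_one_trivial (hE : ReciprocityUpToIrreducibility)
    (K : Type) [Field K] [NumberField K] (ℓ : ℕ) [Fact ℓ.Prime]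
    (v : HeightOneSpectrum (𝓞 K)) (hv : ((ℓ : ℕ) : 𝓞 K) ∈ v.asIdeal) :
    (fontainePstAdicCompletion v ℓ hv).IsWeilDeligneOf
      (1 : FramedRep (absoluteGaloisGroup (v.adicCompletion K)) (PadicAlgCl ℓ) 1)
      (WeilDeligneRep.trivial (PadicAlgCl ℓ) (Fin 1 → PadicAlgCl ℓ)) := by
  obtain ⟨Rec, hRec⟩ := hE K
  obtain ⟨hA, -⟩ := hRec 1 one_pos (isCompact_glFiniteIntegralLevel_holds 1 K)
  obtain ⟨π, hW, hW', hL, hsat⟩ := exists_trivial_cuspidal (isCompact_glFiniteIntegralLevel_holds 1 K)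
  obtain ⟨ι⟩ := PadicAlgCl.nonempty_ringEquiv_complex ℓ
  obtain ⟨ρ, -, hcorr⟩ := hA π hL ℓ ι
  obtain rfl : ρ = 1 := eq_one_of_satakeFrobCompatible_trivial hsat ι ρ hcorr.1
  have h := isWeilDeligneOf_trivial_of_localGlobalCompatibleAt hW hW' Rec ι 1 v (hcorr.2 v) hv
  rwa [toLocal_one] at h

/-- **§B, line form (`stub_pairCompatibility` of line `Sketch` decides the same clause).** The
stub's `∃ Rec` asserts local–global compatibility at every `v` for IRREDUCIBLE pinned-geometric `ρ`
a.e.-compatible with an L-algebraic cuspidal `π`; the pair (`π_𝟙`, `ρ = 1`) qualifies (rank one is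
irreducible; `1` is unramified hence de Rham for every datum; Satake `{1}` a.e.). [folklore] -/
theorem pairCompatibility_isWeilDeligneOf_one_trivial
    (hPC : ∀ (K : Type) [Field K] [NumberField K], ∃ Rec : ReciprocityData K,
      ∀ (n : ℕ) (hcpt : isCompact_glFiniteIntegralLevel n K), 0 < n →
        ∀ (π : CuspidalAutomorphicRepData n K hcpt), π.1.IsLAlgebraic →
          ∀ (ℓ : ℕ) [Fact ℓ.Prime] (ι : PadicAlgCl ℓ ≃+* ℂ) (ρ : FramedGaloisRep K (PadicAlgCl ℓ) n),
            ρ.toGaloisRep.IsIrreducible →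
            ((∀ᶠ v : HeightOneSpectrum (𝓞 K) in cofinite, ρ.IsUnramifiedAt v) ∧
              ∀ (v : HeightOneSpectrum (𝓞 K)) (hv : ((ℓ : ℕ) : 𝓞 K) ∈ v.asIdeal),
                (fontainePstAdicCompletion v ℓ hv).IsDeRhamFramed (ρ.toLocal v)) →
              (∀ᶠ v : HeightOneSpectrum (𝓞 K) in cofinite, SatakeFrobCompatibleAt ι π.1 ρ v) →
                ∀ v : HeightOneSpectrum (𝓞 K), LocalGlobalCompatibleAt Rec ι π.1 ρ v)
    (K : Type) [Field K] [NumberField K] (ℓ : ℕ) [Fact ℓ.Prime]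
    (v : HeightOneSpectrum (𝓞 K)) (hv : ((ℓ : ℕ) : 𝓞 K) ∈ v.asIdeal) :
    (fontainePstAdicCompletion v ℓ hv).IsWeilDeligneOf
      (1 : FramedRep (absoluteGaloisGroup (v.adicCompletion K)) (PadicAlgCl ℓ) 1)
      (WeilDeligneRep.trivial (PadicAlgCl ℓ) (Fin 1 → PadicAlgCl ℓ)) := by
  obtain ⟨Rec, hRec⟩ := hPC K
  obtain ⟨π, hW, hW', hL, hsat⟩ := exists_trivial_cuspidal (isCompact_glFiniteIntegralLevel_holds 1 K)
  obtain ⟨ι⟩ := PadicAlgCl.nonempty_ringEquiv_complex ℓ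
  have hirr := Summit.Langlands.Langlands.Theorems.IrreducibleOffSector.isIrreducible_of_rank_one
    (K := K) (1 : FramedGaloisRep K (PadicAlgCl ℓ) 1)
  have hunr : ∀ w : HeightOneSpectrum (𝓞 K), (1 : FramedGaloisRep K (PadicAlgCl ℓ) 1).IsUnramifiedAt w :=
    fun _ _ _ _ _ => rfl
  have hgeo : (∀ᶠ w : HeightOneSpectrum (𝓞 K) in cofinite,
      (1 : FramedGaloisRep K (PadicAlgCl ℓ) 1).IsUnramifiedAt w) ∧
      ∀ (w : HeightOneSpectrum (𝓞 K)) (hw : ((ℓ : ℕ) : 𝓞 K) ∈ w.asIdeal),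
        (fontainePstAdicCompletion w ℓ hw).IsDeRhamFramed
          ((1 : FramedGaloisRep K (PadicAlgCl ℓ) 1).toLocal w) :=
    ⟨Filter.Eventually.of_forall hunr, fun w hw =>
      (fontainePstAdicCompletion w ℓ hw).isDeRhamFramed_of_isLocallyUnramified fun _ _ => rfl⟩
  have hcompat : ∀ᶠ w : HeightOneSpectrum (𝓞 K) in cofinite,
      SatakeFrobCompatibleAt ι π.1 (1 : FramedGaloisRep K (PadicAlgCl ℓ) 1) w := by
    filter_upwards [hsat] with w hw1
    refine ⟨{1}, hw1, hunr w, ?_⟩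
    rw [arithFrobPolyOfSatake_one, Multiset.map_singleton, Multiset.prod_singleton, inv_one, map_one,
      FramedGaloisRep.hasFrobCharpolyAt_iff_of_rank_one]
    intro _ _ _ _
    rfl
  have h := hRec 1 _ one_pos π hL ℓ ι 1 hirr hgeo hcompat v
  have h' := isWeilDeligneOf_trivial_of_localGlobalCompatibleAt hW hW' Rec ι 1 v h hv
  rwa [toLocal_one] at h'

/-- **The specification pins the clause at the summit's places** (since the 2026-08-16 re-type of
`IsFontaineDatum`, clause (F8)): under `FontaineDatumExists` the pinned datum
`fontainePstAdicCompletion v ℓ hv` attaches the trivial Weil–Deligne representation to `1` at every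
`v ∣ ℓ` — WITHOUT the crux (negative knowledge I, `isWeilDeligneOf_one_trivial_of_isFontaineDatum`,
applied to `isFontaineDatum_fontainePstAdicCompletion`). [folklore] -/
theorem isWeilDeligneOf_one_trivial_fontainePstAdicCompletion (hF : FontaineDatumExists)
    (K : Type) [Field K] [NumberField K] (ℓ : ℕ) [Fact ℓ.Prime]
    (v : HeightOneSpectrum (𝓞 K)) (hv : ((ℓ : ℕ) : 𝓞 K) ∈ v.asIdeal) :
    (fontainePstAdicCompletion v ℓ hv).IsWeilDeligneOf
      (1 : FramedRep (absoluteGaloisGroup (v.adicCompletion K)) (PadicAlgCl ℓ) 1)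
      (WeilDeligneRep.trivial (PadicAlgCl ℓ) (Fin 1 → PadicAlgCl ℓ)) := by
  haveI := LocalField.charZero_adicCompletion v
  exact isWeilDeligneOf_one_trivial_of_isFontaineDatum
    (isFontaineDatum_fontainePstAdicCompletion hF v ℓ hv)

/-- **Deprecated record.** Formerly the SEPARATION statement: under the crux and
`FontaineDatumExists`, at every `v ∣ ℓ` some datum with all of Fontaine's clauses disagrees with the
pinned datum on the clause `IsWeilDeligneOf 1 trivial`. True of the 2026-08-16 specification
(F1)–(F7); FALSE since clause (F8) was added (every datum with the clauses satisfies the clause), so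
the name is kept as an alias of the positive statement for the pinned datum. [folklore] -/
@[deprecated isWeilDeligneOf_one_trivial_fontainePstAdicCompletion (since := "2026-08-17")]
alias reciprocityUpToIrreducibility_separates_fontaineSpec :=
  isWeilDeligneOf_one_trivial_fontainePstAdicCompletion

/-- **Summit form.** `Langlands` itself decides `WDT` of the pinned datum (through
`Langlands → ReciprocityUpToIrreducibility`, p78886); so the SUMMIT STATEMENT, as pinned on
2026-08-16 (D-0018 L2), is not closable before the upgrade path of `FontaineDpst` is taken.
[folklore] -/
theorem langlands_isWeilDeligneOf_one_trivial (hL : _root_.Langlands) (K : Type) [Field K] [NumberField K]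
    (ℓ : ℕ) [Fact ℓ.Prime] (v : HeightOneSpectrum (𝓞 K)) (hv : ((ℓ : ℕ) : 𝓞 K) ∈ v.asIdeal) :
    (fontainePstAdicCompletion v ℓ hv).IsWeilDeligneOf
      (1 : FramedRep (absoluteGaloisGroup (v.adicCompletion K)) (PadicAlgCl ℓ) 1)
      (WeilDeligneRep.trivial (PadicAlgCl ℓ) (Fin 1 → PadicAlgCl ℓ)) :=
  reciprocityUpToIrreducibility_isWeilDeligneOf_one_trivial
    (langlands_iff_reciprocityUpToIrreducibility_and_irreducible.mp hL).1 K ℓ v hv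

/-- The absolute form at the summit's places: whatever `Classical.epsilon` returns, the TYPE of the
pinned datum has inhabitants violating the clause. [folklore] -/
theorem exists_not_isWeilDeligneOf_one_trivial_adicCompletion (K : Type) [Field K] [NumberField K] (ℓ : ℕ)
    [Fact ℓ.Prime] (v : HeightOneSpectrum (𝓞 K)) (hv : ((ℓ : ℕ) : 𝓞 K) ∈ v.asIdeal) :
    ∃ 𝔇 : PstWeilDeligneData (v.adicCompletion K) ℓ,
      ¬ (𝔇).IsWeilDeligneOf
      (1 : FramedRep (absoluteGaloisGroup (v.adicCompletion K)) (PadicAlgCl ℓ) 1)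
      (WeilDeligneRep.trivial (PadicAlgCl ℓ) (Fin 1 → PadicAlgCl ℓ)) := by
  haveI := LocalField.charZero_adicCompletion v
  exact exists_not_isWeilDeligneOf_one_trivial (LocalField.valuation_adicCompletion_natCast_lt_one v ℓ hv)


/-- **Headline, spec form (re-typed specification).** At the summit's places EVERY datum with
Fontaine's clauses (F1)–(F8) attaches the trivial Weil–Deligne representation to `1`: the clause the
crux decides IS now a consequence of `IsFontaineDatum` (clause (F8); negative knowledge I). [folklore] -/
theorem forall_isFontaineDatum_isWeilDeligneOf_one_trivial
    (K : Type) [Field K] [NumberField K] (ℓ : ℕ) [Fact ℓ.Prime] (v : HeightOneSpectrum (𝓞 K))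
    (hv : ((ℓ : ℕ) : 𝓞 K) ∈ v.asIdeal) :
    ∀ 𝔇 : PstWeilDeligneData (v.adicCompletion K) ℓ,
        (haveI := LocalField.charZero_adicCompletion v
         IsFontaineDatum (LocalField.valuation_adicCompletion_natCast_lt_one v ℓ hv) 𝔇) →
        𝔇.IsWeilDeligneOf (1 : FramedRep (absoluteGaloisGroup (v.adicCompletion K)) (PadicAlgCl ℓ) 1)
          (WeilDeligneRep.trivial (PadicAlgCl ℓ) (Fin 1 → PadicAlgCl ℓ)) := by
  haveI := LocalField.charZero_adicCompletion v
  intro 𝔇 h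
  exact isWeilDeligneOf_one_trivial_of_isFontaineDatum h

/-- **Deprecated record.** Formerly the negation of the statement above, under `FontaineDatumExists`
("Fontaine's specification does NOT imply the clause the crux decides") — true of the 2026-08-16
specification (F1)–(F7), FALSE since clause (F8) was added; the name is kept as an alias of the
positive statement. [folklore] -/
@[deprecated forall_isFontaineDatum_isWeilDeligneOf_one_trivial (since := "2026-08-17")]
alias not_forall_isFontaineDatum_isWeilDeligneOf_one_trivial :=
  forall_isFontaineDatum_isWeilDeligneOf_one_trivial

end Summit.Langlands.Langlands.Theorems.ReciprocityUpToIrreducibility.Negative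

end
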